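import Summits.ResolutionOfSingularities.ResolutionOfSingularities.Theorems.PurelyInseparableDim4AtlasOwnedSets
import Summits.ResolutionOfSingularities.ResolutionOfSingularities.Theorems.PurelyInseparableDim4AtlasMemberBasics
import HarnessLib

/-!
# Purely inseparable four-folds: the READINGS of a linear escaping child — combinatorics of centres, deferrals, owned subspaces and
# bundle directions (brick S3 (c) v4, tranche 1, brick A1-readings; cell `res-dim4-pi`)

[OURS · counted 0] (D-0157 DOOR 2; host item stmt-ResolutionOfSingularities-16155, helper). Nothing here proves resolution of
singularities in dimension ≥ 4 / characteristic `p`. Finite bookkeeping for the child package A1 (`res-dim4-typ-3/S3c-V4-ATLAS-MEMBERS-DESIGN.md`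
§7, §9 (I2)): for an entry `(j, b, S″)` (`j ∈ S ∩ S″`) at a reading `(s, S, X, D)` whose deferral indices lie in `D ⊆ S″ ∖ S` (the format
invariant of generated readings), the inherited deferrals VANISH under `shiftDefer` in the main and in every extra reading, so the owned
subspaces of the child's readings are the OWNED PIECES «first chart that sees the point» for the ranking `rk j = 0`, `rk l = l + 1`
(charts `insert j (S ∖ S″)`): main = all of `V(z, x_{S″})`, extra `l` = `V(z, x_{T_l}) ∩ {x_j = 0, x_{l′} = 0 (l′ ∈ S ∖ S″, l′ < l)}`;
the reading map `m ↦ main / extra m` is injective on the charts with image `insert main (image extra)`.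

* `shiftDefer_eq_empty_of_indices`, `ownedSetZ_image_eq`, `childReading_main`, `childReading_extra`, `ownedSetZ_mainReading_eq_piece`,
  `ownedSetZ_extraReading_eq_piece`, `childReading_injOn`, `image_childReading_eq`.

AI-produced formalisation, weaker than expert review. bears_on: LADDER-RESOLUTION:D157-DOOR2 (res-dim4-pi · S3 (c) v4 A1-readings).
-/

set_option linter.dupNamespace false -- D-0017: single-problem summit path `Summit.<S>.<S>.…` by design

noncomputable section

open MvPolynomial Finset CategoryTheory AlgebraicGeometry Opposite TopologicalSpace

namespace Summit.ResolutionOfSingularities.ResolutionOfSingularities.Theorems.PIDim4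

open Literature.AlgebraicGeometry.Resolution
open Literature.AlgebraicGeometry.Resolution.Hauser2010
open Literature.AlgebraicGeometry.Resolution.AffinePointBlowup (P A γ coord Wtop ξ)

namespace Equimultiple

section ChildReadings

variable {K : Type} [Field K] (p : ℕ) [DecidableEq K]

omit [DecidableEq K] in
/-- **Inherited deferrals vanish**: if every deferred index lies in `D ⊆ T`, then `shiftDefer b T X = ∅`. [folklore] -/
theorem shiftDefer_eq_empty_of_indices [DecidableEq K] {X : Finset (Fin 4 × K)} {D T : Finset (Fin 4)} (hX : ∀ iv ∈ X, iv.1 ∈ D)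
    (hDT : D ⊆ T) (b : Fin 4 → K) : shiftDefer b T X = ∅ := by
  rw [shiftDefer, Finset.filter_eq_empty_iff]
  intro iv hiv
  obtain ⟨iv', hiv', rfl⟩ := Finset.mem_image.mp hiv
  exact not_not.mpr (hDT (hX iv' hiv'))

/-- The owned subspace for the deferral set `{(i, v_i) : i ∈ D}`, unfolded. [folklore] -/
theorem ownedSetZ_image_eq (T D : Finset (Fin 4)) (v : Fin 4 → K) :
    ownedSetZ T (D.image fun i => (i, v i)) =
      (AffineCoordBlowup.CΛ 4 K (insert 0 (Fin.succ '' (T : Set (Fin 4)))) : Set (P 4 K)) ∩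
        {x : P 4 K | ∀ i ∈ D, (X i.succ - C (v i) : A 4 K) ∈ x.asIdeal} := by
  ext x
  simp only [ownedSetZ, Set.mem_setOf_eq, Set.mem_inter_iff, Finset.mem_image, forall_exists_index, and_imp,
    forall_apply_eq_imp_iff₂]

variable (s : State K) (S : Finset (Fin 4)) (Xd : Finset (Fin 4 × K)) (Dd : Finset (Fin 4)) (j : Fin 4) (b : Fin 4 → K)
  (S'' : Finset (Fin 4))

/-- The centre, state and bundle directions of the main reading. [folklore] -/
theorem childReading_main :
    (mainReading p (s, S, Xd, Dd) (j, b, S'')).2.1 = S'' ∧ (mainReading p (s, S, Xd, Dd) (j, b, S'')).1 = CentreBlowup.step p S j b s ∧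
      (mainReading p (s, S, Xd, Dd) (j, b, S'')).2.2.2 = S \ S'' := ⟨rfl, rfl, rfl⟩

/-- The centre, state and bundle directions of an extra reading. [folklore] -/
theorem childReading_extra (l : Fin 4) :
    (extraReading p (s, S, Xd, Dd) (j, b, S'') l).2.1 = insert l (S''.erase j) ∧
      (extraReading p (s, S, Xd, Dd) (j, b, S'') l).1 = escState p S l b s ∧
      (extraReading p (s, S, Xd, Dd) (j, b, S'') l).2.2.2 = (insert j (S \ S'')).erase l := ⟨rfl, rfl, rfl⟩

variable {S Xd Dd j S''}

/-- **The main reading owns all of `V(z, x_{S″})`** — the owned piece of chart `j` for any ranking with `rk j = 0`.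
[cite: BierstoneGrigorievMilmanWlodarczyk2011, Def. 3.1.3 (4)] -/
theorem ownedSetZ_mainReading_eq_piece (hXd : ∀ iv ∈ Xd, iv.1 ∈ Dd) (hDd : ∀ m ∈ Dd, m ∈ S'' ∧ m ∉ S) (rk : Fin 4 → ℕ)
    (hrk : rk j = 0) :
    ownedSetZ (mainReading p (s, S, Xd, Dd) (j, b, S'')).2.1 (mainReading p (s, S, Xd, Dd) (j, b, S'')).2.2.1 =
      (AffineCoordBlowup.CΛ 4 K (insert 0 (Fin.succ '' (S'' : Set (Fin 4)))) : Set (P 4 K)) ∩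
        {y : P 4 K | ∀ m' ∈ insert j (S \ S''), rk m' < rk j → (X m'.succ : A 4 K) ∈ y.asIdeal} := by
  have h1 : (mainReading p (s, S, Xd, Dd) (j, b, S'')).2.2.1 = ∅ := by
    change shiftDefer b S'' Xd = ∅
    exact shiftDefer_eq_empty_of_indices hXd (fun m hm => (hDd m hm).1) b
  rw [h1, (childReading_main p s S Xd Dd j b S'').1, ownedSetZ_empty]
  ext y
  simp only [Set.mem_inter_iff, Set.mem_setOf_eq, hrk, Nat.not_lt_zero, IsEmpty.forall_iff, implies_true, and_true]

/-- **The extra reading on chart `l` owns the part of `V(z, x_{T_l})` with `x_j = 0` and `x_{l′} = 0` for the earlier extra charts** —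
the owned piece of chart `l` for the ranking `rk j = 0`, `rk m = m + 1` (`m ≠ j`). [cite: BierstoneGrigorievMilmanWlodarczyk2011, Def. 3.1.3 (4)] -/
theorem ownedSetZ_extraReading_eq_piece (hj : j ∈ S) (hjS'' : j ∈ S'') (hXd : ∀ iv ∈ Xd, iv.1 ∈ Dd) (hDd : ∀ m ∈ Dd, m ∈ S'' ∧ m ∉ S)
    {l : Fin 4} (hl : l ∈ S \ S'') :
    ownedSetZ (extraReading p (s, S, Xd, Dd) (j, b, S'') l).2.1 (extraReading p (s, S, Xd, Dd) (j, b, S'') l).2.2.1 =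
      (AffineCoordBlowup.CΛ 4 K (insert 0 (Fin.succ '' ((insert l (S''.erase j) : Finset (Fin 4)) : Set (Fin 4)))) : Set (P 4 K)) ∩
        {y : P 4 K | ∀ m' ∈ insert j (S \ S''), (if m' = j then 0 else m'.val + 1) < (if l = j then 0 else l.val + 1) →
          (X m'.succ : A 4 K) ∈ y.asIdeal} := by
  have hlj : l ≠ j := by rintro rfl; exact (Finset.mem_sdiff.mp hl).2 hjS''
  have h1 : shiftDefer b (insert l (S''.erase j)) Xd = ∅ := by
    refine shiftDefer_eq_empty_of_indices hXd (fun m hm => ?_) b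
    have hmj : m ≠ j := fun h => (hDd m hm).2 (h ▸ hj)
    exact Finset.mem_insert_of_mem (Finset.mem_erase.mpr ⟨hmj, (hDd m hm).1⟩)
  have h2 : (extraReading p (s, S, Xd, Dd) (j, b, S'') l).2.2.1 =
      (insert j ((S \ S'').filter fun l' => l' < l)).image fun l' => (l', (0 : K)) := by
    change shiftDefer b (insert l (S''.erase j)) Xd ∪ insert (j, (0 : K)) (((S \ S'').filter fun l' => l' < l).image fun l' => (l', (0 : K))) = _
    rw [h1, Finset.empty_union, Finset.image_insert]
  rw [h2, (childReading_extra p s S Xd Dd j b S'' l).1, ownedSetZ_image_zero]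
  ext y
  simp only [Set.mem_inter_iff, Set.mem_setOf_eq, and_congr_right_iff]
  intro _
  constructor
  · intro h m' hm' hlt
    rcases Finset.mem_insert.mp hm' with hm'j | hm'S
    · rw [hm'j]; exact h _ (Finset.mem_insert_self _ _)
    · have hm'j : m' ≠ j := fun hh => (Finset.mem_sdiff.mp hm'S).2 (hh ▸ hjS'')
      rw [if_neg hm'j, if_neg hlj, Nat.add_lt_add_iff_right] at hlt
      exact h m' (Finset.mem_insert_of_mem (Finset.mem_filter.mpr ⟨hm'S, Fin.lt_def.mpr hlt⟩))
  · intro h m' hm'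
    rcases Finset.mem_insert.mp hm' with hm'j | hm'F
    · rw [hm'j]
      refine h _ (Finset.mem_insert_self _ _) ?_
      rw [if_pos rfl, if_neg hlj]
      exact Nat.zero_lt_succ _
    · obtain ⟨hm'S, hlt⟩ := Finset.mem_filter.mp hm'F
      have hm'j : m' ≠ j := fun hh => (Finset.mem_sdiff.mp hm'S).2 (hh ▸ hjS'')
      refine h m' (Finset.mem_insert_of_mem hm'S) ?_
      rw [if_neg hm'j, if_neg hlj, Nat.add_lt_add_iff_right]
      exact Fin.lt_def.mp hlt

/-- **The reading map of a linear escaping child is injective on its charts** (the centres already differ). [folklore] -/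
theorem childReading_injOn :
    ∀ m ∈ insert j (S \ S''), ∀ m' ∈ insert j (S \ S''),
      (fun m : Fin 4 => if m = j then mainReading p (s, S, Xd, Dd) (j, b, S'') else extraReading p (s, S, Xd, Dd) (j, b, S'') m) m =
      (fun m : Fin 4 => if m = j then mainReading p (s, S, Xd, Dd) (j, b, S'') else extraReading p (s, S, Xd, Dd) (j, b, S'') m) m' →
      m = m' := by
  intro m hm m' hm' h
  have hT := congrArg (fun r : AReading K => r.2.1) h
  simp only at hT
  have hnot : ∀ l ∈ insert j (S \ S''), l ≠ j → l ∉ S'' := fun l hl hlj => by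
    rcases Finset.mem_insert.mp hl with h | h
    · exact absurd h hlj
    · exact (Finset.mem_sdiff.mp h).2
  by_cases hmj : m = j <;> by_cases hm'j : m' = j
  · rw [hmj, hm'j]
  · exfalso
    rw [if_pos hmj, if_neg hm'j, (childReading_main p s S Xd Dd j b S'').1, (childReading_extra p s S Xd Dd j b S'' m').1] at hT
    exact hnot m' hm' hm'j (hT.symm ▸ Finset.mem_insert_self _ _)
  · exfalso
    rw [if_neg hmj, if_pos hm'j, (childReading_main p s S Xd Dd j b S'').1, (childReading_extra p s S Xd Dd j b S'' m).1] at hT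
    exact hnot m hm hmj (hT ▸ Finset.mem_insert_self _ _)
  · rw [if_neg hmj, if_neg hm'j, (childReading_extra p s S Xd Dd j b S'' m).1, (childReading_extra p s S Xd Dd j b S'' m').1] at hT
    have h1 : m ∈ insert m' (S''.erase j) := hT ▸ Finset.mem_insert_self _ _
    rcases Finset.mem_insert.mp h1 with h | h
    · exact h
    · exact absurd (Finset.mem_of_mem_erase h) (hnot m hm hmj)

/-- **The readings of a linear escaping child are the images of its charts**: `insert main (image extra (S ∖ S″)) = image rd (insert j (S ∖ S″))`.
[folklore] -/
theorem image_childReading_eq [DecidableEq (AReading K)] (hjS'' : j ∈ S'') :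
    (insert j (S \ S'')).image
        (fun m : Fin 4 => if m = j then mainReading p (s, S, Xd, Dd) (j, b, S'') else extraReading p (s, S, Xd, Dd) (j, b, S'') m) =
      insert (mainReading p (s, S, Xd, Dd) (j, b, S'')) ((S \ S'').image fun l => extraReading p (s, S, Xd, Dd) (j, b, S'') l) := by
  rw [Finset.image_insert, if_pos rfl]
  congr 1
  refine Finset.image_congr fun l hl => ?_
  have hlj : l ≠ j := by rintro rfl; exact (Finset.mem_sdiff.mp (Finset.mem_coe.mp hl)).2 hjS''
  simp only [if_neg hlj]

end ChildReadings

end Equimultiple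

end Summit.ResolutionOfSingularities.ResolutionOfSingularities.Theorems.PIDim4

end
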